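import Literature.Computability.Complexity.FourierDegreeAlgebra
import HarnessLib

/-!
# The Friedgut–Kalai–Naor theorem (proved): a Boolean function whose Fourier weight is
# concentrated on levels `≤ 1` is close to a dictator or to a constant

Source: E. Friedgut, G. Kalai, A. Naor, *Boolean functions whose Fourier transform is concentrated on
the first two levels*, Adv. Appl. Math. 29 (2002) 427–437 [FriedgutKalaiNaor2002], Theorem 1.1
(p. 428, verbatim): "If `f` is a Boolean function, `‖f‖₂² = p` and if `Σ_{|S|>1} f̂²(S) ≤ δ` then either
`p < Kδ` or `p > 1 − Kδ` or `‖f − x_i‖₂² ≤ Kδ` for some `i` or `‖f − (1 − x_i)‖₂² ≤ Kδ` for some `i`.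
Here, `K` [is an] absolute constant."  We prove it in the `±1` reading of the tree's cube Fourier
vocabulary (`Literature.Computability.Complexity.LowDegree`: `cubeFourierCoeff`, `walsh`, `IsLevelLE`,
Parseval `sum_cubeFourierCoeff_sq`, the Bonami lemma `IsLevelLE.bonami_even_moment`): for
`F : {0,1}^m → {−1, 1}` with `η = Σ_{|S| ≥ 2} F̂(S)²`, one of `±1, ±χ_i` is `4000 η`-close to `F` in
`E[(F − g)²]` (`FKN.fkn_pm_one`), with the explicit (unoptimised) constant `4000`.

THE PROOF (the hypercontractive argument, O'Donnell 2014 §9 style; FKN's own proofs use Beckner's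
inequality resp. a theorem of König–Schütt–Tomczak-Jaegermann, [FriedgutKalaiNaor2002, §2–§3]): let
`ℓ = F^{≤1} = a + Σ_i b_i χ_i` be the projection of `F` to levels `≤ 1` (`lowPart`), `h = F − ℓ`,
`E[h²] = η`, `Λ = E[ℓ²] = a² + Σ b_i² = 1 − η` (Parseval). The level-`≤ 2` polynomial `q = ℓ² − Λ`
has `E|q| ≤ E|ℓ² − F²| + η ≤ E[|h|(2 + |h|)] + η ≤ 2√η + 2η ≤ 4√η`; by Bonami (`E q⁴ ≤ 81 (E q²)²`)
and two Cauchy–Schwarz steps, `E q² ≤ 81 (E|q|)² ≤ 1296 η`. Reading off the coefficients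
`q̂({k}) = 2 a b_k`, `q̂({k,l}) = 2 b_k b_l` (convolution formula) gives `4a² B ≤ 1296 η` and
`2(B² − Σ b_k⁴) ≤ 1296 η` (`B = Σ b_k²`), whence: if `B ≥ 1/2` then `a² ≤ 648η`, some `b_k² ≥ 1 − 1945η`
and `E[(F ∓ χ_k)²] = 2 − 2|b_k| ≤ 3890 η`; if `B < 1/2` then `B ≤ 1296 η·…` and `E[(F ∓ 1)²] ≤ 2594 η`
(for `η ≤ 1/4`; for `η > 1/4` the bound `4000 η ≥ 4` is trivial).

Consumer: the discharge `FriedgutKalaiNaor2002_thm_holds` of the named fact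
`Literature.Combinatorics.AssociationSchemes.SliceFKN.FriedgutKalaiNaor2002_thm` (file
`Combinatorics/AssociationSchemes/SliceFKN.lean`, which states FKN for `{0,1}`-valued functions on
subsets `ε`-close to an affine function). No facts, no instances, standard axioms.

## References
* [FriedgutKalaiNaor2002] Adv. Appl. Math. 29 (2002) 427–437, Thm. 1.1 (held
  `paper:doi-10-1016-s0196-8858-02-00024-6`, p. 428).
* [ODonnell2014] R. O'Donnell, *Analysis of Boolean Functions*, CUP 2014, §9.1 (Bonami lemma; tree
  `bonami_even_moment`), §1.4 (Parseval, convolution).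
-/

noncomputable section

namespace Literature.Computability.Complexity.LowDegree

open Finset Literature.Probability.RandomGraphs.LowDegree
open scoped symmDiff BigOperators

namespace FKN

variable {m : ℕ}

/-! ### §1 The projection to levels `≤ 1` and its complement -/

/-- The sets of size `≤ 1`: `∅` and the singletons. [cite: ODonnell2014, §1.4] -/
theorem filter_card_le_one_eq :
    (univ.filter fun S : Finset (Fin m) => S.card ≤ 1) =
      insert ∅ (univ.map ⟨fun i : Fin m => ({i} : Finset (Fin m)), singleton_injective⟩) := by
  ext T
  simp only [mem_filter, mem_univ, true_and, mem_insert, mem_map, Function.Embedding.coeFn_mk]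
  constructor
  · intro hT
    rcases Nat.le_one_iff_eq_zero_or_eq_one.1 hT with h0 | h1
    · exact Or.inl (card_eq_zero.1 h0)
    · obtain ⟨i, rfl⟩ := card_eq_one.1 h1
      exact Or.inr ⟨i, rfl⟩
  · rintro (rfl | ⟨i, rfl⟩)
    · simp
    · simp

/-- Summing over the sets of size `≤ 1`: `Σ_{|S| ≤ 1} φ(S) = φ(∅) + Σ_i φ({i})`. [cite: ODonnell2014, §1.4] -/
theorem sum_filter_card_le_one (φ : Finset (Fin m) → ℝ) :
    ∑ S ∈ univ.filter (fun S : Finset (Fin m) => S.card ≤ 1), φ S = φ ∅ + ∑ i : Fin m, φ {i} := by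
  rw [filter_card_le_one_eq, sum_insert (by simp), sum_map]
  rfl

/-- The **projection of `F` to Fourier levels `≤ 1`**: `F^{≤1} = Σ_{|S| ≤ 1} F̂(S) χ_S = F̂(∅) + Σ_i F̂({i}) χ_{i}`.
[cite: ODonnell2014, §1.4] -/
def lowPart (F : (Fin m → Bool) → ℝ) : (Fin m → Bool) → ℝ := fun x =>
  ∑ S ∈ univ.filter (fun S : Finset (Fin m) => S.card ≤ 1), cubeFourierCoeff F S * walsh S x

/-- Coefficients of the projection: `(F^{≤1})^(T) = F̂(T)` for `|T| ≤ 1`, `0` otherwise.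
[cite: ODonnell2014, §1.4] -/
theorem cubeFourierCoeff_lowPart (F : (Fin m → Bool) → ℝ) (T : Finset (Fin m)) :
    cubeFourierCoeff (lowPart F) T = if T.card ≤ 1 then cubeFourierCoeff F T else 0 := by
  unfold lowPart
  rw [cubeFourierCoeff_sum]
  have : ∀ S ∈ univ.filter (fun S : Finset (Fin m) => S.card ≤ 1),
      cubeFourierCoeff (fun x => cubeFourierCoeff F S * walsh S x) T =
        if S = T then cubeFourierCoeff F S else 0 := by
    intro S _
    rw [cubeFourierCoeff_const_mul, cubeFourierCoeff_walsh]
    split_ifs <;> simp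
  rw [sum_congr rfl this, sum_ite_eq' (univ.filter fun S : Finset (Fin m) => S.card ≤ 1) T]
  simp only [mem_filter, mem_univ, true_and]

/-- `F^{≤1}` has level `≤ 1`. [cite: ODonnell2014, §1.4] -/
theorem isLevelLE_lowPart (F : (Fin m → Bool) → ℝ) : IsLevelLE 1 (lowPart F) := by
  intro T hT
  rw [cubeFourierCoeff_lowPart, if_neg (by omega)]

/-- Coefficients of the high part `h = F − F^{≤1}`: `ĥ(T) = F̂(T)` for `|T| ≥ 2`, `0` otherwise.
[cite: ODonnell2014, §1.4] -/
theorem cubeFourierCoeff_highPart (F : (Fin m → Bool) → ℝ) (T : Finset (Fin m)) :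
    cubeFourierCoeff (fun x => F x - lowPart F x) T = if T.card ≤ 1 then 0 else cubeFourierCoeff F T := by
  rw [cubeFourierCoeff_sub, cubeFourierCoeff_lowPart]
  split_ifs <;> ring

/-- The **weight above level `1`**: `η(F) = Σ_{|S| ≥ 2} F̂(S)²`. [cite: FriedgutKalaiNaor2002, Thm. 1.1 (p. 428, "Σ_{|S|>1} f̂²(S) ≤ δ")] -/
def highWeight (F : (Fin m → Bool) → ℝ) : ℝ :=
  ∑ S ∈ univ.filter (fun S : Finset (Fin m) => ¬ S.card ≤ 1), cubeFourierCoeff F S ^ 2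

/-- `η(F) ≥ 0`. [cite: FriedgutKalaiNaor2002, Thm. 1.1 (p. 428)] -/
theorem highWeight_nonneg (F : (Fin m → Bool) → ℝ) : 0 ≤ highWeight F :=
  sum_nonneg fun _ _ => sq_nonneg _

/-- **Parseval for the high part**: `E[(F − F^{≤1})²] = η(F)`. [cite: ODonnell2014, §1.4 (Parseval)] -/
theorem mean_sq_highPart (F : (Fin m → Bool) → ℝ) :
    (∑ x, (F x - lowPart F x) ^ 2) / 2 ^ m = highWeight F := by
  rw [← sum_cubeFourierCoeff_sq]
  simp_rw [cubeFourierCoeff_highPart]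
  rw [highWeight, ← sum_filter_add_sum_filter_not univ (fun S : Finset (Fin m) => S.card ≤ 1)]
  have h1 : ∑ S ∈ univ.filter (fun S : Finset (Fin m) => S.card ≤ 1),
      (if S.card ≤ 1 then (0 : ℝ) else cubeFourierCoeff F S) ^ 2 = 0 :=
    sum_eq_zero fun S hS => by rw [if_pos (mem_filter.1 hS).2]; ring
  have h2 : ∑ S ∈ univ.filter (fun S : Finset (Fin m) => ¬ S.card ≤ 1),
      (if S.card ≤ 1 then (0 : ℝ) else cubeFourierCoeff F S) ^ 2 =
      ∑ S ∈ univ.filter (fun S : Finset (Fin m) => ¬ S.card ≤ 1), cubeFourierCoeff F S ^ 2 :=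
    sum_congr rfl fun S hS => by rw [if_neg (mem_filter.1 hS).2]
  rw [h1, h2, zero_add]

/-- The **weight on levels `≤ 1`**: `Λ(F) = Σ_{|S| ≤ 1} F̂(S)² = F̂(∅)² + Σ_i F̂({i})²`.
[cite: ODonnell2014, §1.4] -/
def lowWeight (F : (Fin m → Bool) → ℝ) : ℝ :=
  ∑ S ∈ univ.filter (fun S : Finset (Fin m) => S.card ≤ 1), cubeFourierCoeff F S ^ 2

/-- `Λ(F) = a² + Σ_i b_i²`. [cite: ODonnell2014, §1.4] -/
theorem lowWeight_eq (F : (Fin m → Bool) → ℝ) :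
    lowWeight F = cubeFourierCoeff F ∅ ^ 2 + ∑ i : Fin m, cubeFourierCoeff F {i} ^ 2 := by
  unfold lowWeight
  rw [sum_filter_card_le_one]

/-- **Parseval for the projection**: `E[(F^{≤1})²] = Λ(F)`. [cite: ODonnell2014, §1.4 (Parseval)] -/
theorem mean_sq_lowPart (F : (Fin m → Bool) → ℝ) :
    (∑ x, lowPart F x ^ 2) / 2 ^ m = lowWeight F := by
  rw [← sum_cubeFourierCoeff_sq]
  simp_rw [cubeFourierCoeff_lowPart]
  rw [lowWeight, ← sum_filter_add_sum_filter_not univ (fun S : Finset (Fin m) => S.card ≤ 1)]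
  have h1 : ∑ S ∈ univ.filter (fun S : Finset (Fin m) => S.card ≤ 1),
      (if S.card ≤ 1 then cubeFourierCoeff F S else 0) ^ 2 =
      ∑ S ∈ univ.filter (fun S : Finset (Fin m) => S.card ≤ 1), cubeFourierCoeff F S ^ 2 :=
    sum_congr rfl fun S hS => by rw [if_pos (mem_filter.1 hS).2]
  have h2 : ∑ S ∈ univ.filter (fun S : Finset (Fin m) => ¬ S.card ≤ 1),
      (if S.card ≤ 1 then cubeFourierCoeff F S else 0) ^ 2 = 0 :=
    sum_eq_zero fun S hS => by rw [if_neg (mem_filter.1 hS).2]; ring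
  rw [h1, h2, add_zero]

/-- **Parseval split by level**: `E[F²] = Λ(F) + η(F)`. [cite: ODonnell2014, §1.4 (Parseval)] -/
theorem mean_sq_eq_lowWeight_add_highWeight (F : (Fin m → Bool) → ℝ) :
    (∑ x, F x ^ 2) / 2 ^ m = lowWeight F + highWeight F := by
  rw [← sum_cubeFourierCoeff_sq, lowWeight, highWeight,
    ← sum_filter_add_sum_filter_not univ (fun S : Finset (Fin m) => S.card ≤ 1)]

/-- For a level-`≤ 1` function `ℓ`, `E[(F − ℓ)²] ≥ η(F)`: the projection `F^{≤1}` is the closest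
level-`≤ 1` function, so "`ε`-close to an affine function" implies `η(F) ≤ ε`.
[cite: FriedgutKalaiNaor2002, Thm. 1.1 (p. 428)] -/
theorem highWeight_le_mean_sq_sub {F ℓ : (Fin m → Bool) → ℝ} (hℓ : IsLevelLE 1 ℓ) :
    highWeight F ≤ (∑ x, (F x - ℓ x) ^ 2) / 2 ^ m := by
  rw [← sum_cubeFourierCoeff_sq, highWeight,
    ← sum_filter_add_sum_filter_not univ (fun S : Finset (Fin m) => S.card ≤ 1)]
  have h2 : ∑ S ∈ univ.filter (fun S : Finset (Fin m) => ¬ S.card ≤ 1),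
      cubeFourierCoeff (fun x => F x - ℓ x) S ^ 2 =
      ∑ S ∈ univ.filter (fun S : Finset (Fin m) => ¬ S.card ≤ 1), cubeFourierCoeff F S ^ 2 :=
    sum_congr rfl fun S hS => by
      rw [cubeFourierCoeff_sub, hℓ S (by have := (mem_filter.1 hS).2; omega), sub_zero]
  rw [h2]
  have : 0 ≤ ∑ S ∈ univ.filter (fun S : Finset (Fin m) => S.card ≤ 1),
      cubeFourierCoeff (fun x => F x - ℓ x) S ^ 2 := sum_nonneg fun _ _ => sq_nonneg _
  linarith


/-! ### §2 The level-`≤ 2` polynomial `q = (F^{≤1})² − Λ` and its coefficients -/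

/-- `q = (F^{≤1})² − Λ(F)`, a polynomial of level `≤ 2`. [cite: ODonnell2014, §9.1] -/
def qFn (F : (Fin m → Bool) → ℝ) : (Fin m → Bool) → ℝ := fun x => lowPart F x * lowPart F x - lowWeight F

/-- `q` has level `≤ 2`. [cite: ODonnell2014, §1.4 (degree of a product)] -/
theorem isLevelLE_qFn (F : (Fin m → Bool) → ℝ) : IsLevelLE 2 (qFn F) :=
  ((isLevelLE_lowPart F).mul (isLevelLE_lowPart F)).sub (isLevelLE_const _ _)

/-- `∅ Δ S = S`. [cite: ODonnell2014, §1.4] -/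
private theorem empty_symmDiff (S : Finset (Fin m)) : (∅ : Finset (Fin m)) ∆ S = S := by
  ext x; simp [Finset.mem_symmDiff]

/-- `{i} Δ {k} = {i, k}` has two elements for `i ≠ k`. [cite: ODonnell2014, §1.4] -/
private theorem card_singleton_symmDiff_singleton {i k : Fin m} (h : i ≠ k) :
    (({i} : Finset (Fin m)) ∆ {k}).card = 2 := by
  have : ({i} : Finset (Fin m)) ∆ {k} = {i, k} := by
    ext x
    simp only [Finset.mem_symmDiff, mem_singleton, mem_insert]
    by_cases hxi : x = i
    · subst hxi; simp [h]
    · by_cases hxk : x = k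
      · subst hxk; simp [hxi]
      · simp [hxi, hxk]
  rw [this, card_pair h]

/-- `{k} Δ {k, l} = {l}` for `k ≠ l`. [cite: ODonnell2014, §1.4] -/
private theorem singleton_symmDiff_pair_left {k l : Fin m} (h : k ≠ l) :
    (({k} : Finset (Fin m)) ∆ {k, l}) = {l} := by
  ext x
  simp only [Finset.mem_symmDiff, mem_singleton, mem_insert]
  by_cases hxk : x = k
  · subst hxk; simp [h]
  · simp [hxk]

/-- `{l} Δ {k, l} = {k}` for `k ≠ l`. [cite: ODonnell2014, §1.4] -/
private theorem singleton_symmDiff_pair_right {k l : Fin m} (h : k ≠ l) :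
    (({l} : Finset (Fin m)) ∆ {k, l}) = {k} := by
  rw [pair_comm]; exact singleton_symmDiff_pair_left (Ne.symm h)

/-- `{i} Δ {k, l} = {i, k, l}` has three elements for `i ∉ {k, l}`, `k ≠ l`. [cite: ODonnell2014, §1.4] -/
private theorem card_singleton_symmDiff_pair {i k l : Fin m} (hkl : k ≠ l) (hik : i ≠ k) (hil : i ≠ l) :
    (({i} : Finset (Fin m)) ∆ {k, l}).card = 3 := by
  have : ({i} : Finset (Fin m)) ∆ {k, l} = {i, k, l} := by
    ext x
    simp only [Finset.mem_symmDiff, mem_singleton, mem_insert]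
    by_cases hxi : x = i
    · subst hxi; simp [hik, hil]
    · by_cases hxk : x = k
      · subst hxk; simp [hxi, hkl]
      · by_cases hxl : x = l
        · subst hxl; simp [hxi, hxk]
        · simp [hxi, hxk, hxl]
  rw [this, card_insert_of_notMem (by simp [hik, hil]), card_pair hkl]

/-- **Convolution formula for `(F^{≤1})²`**: `((F^{≤1})²)^(U) = Σ_{|S| ≤ 1, |S Δ U| ≤ 1} F̂(S) F̂(S Δ U)`.
[cite: ODonnell2014, §1.4 (coefficients of a product)] -/
theorem cubeFourierCoeff_lowPart_sq (F : (Fin m → Bool) → ℝ) (U : Finset (Fin m)) :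
    cubeFourierCoeff (fun x => lowPart F x * lowPart F x) U =
      cubeFourierCoeff F ∅ * (if U.card ≤ 1 then cubeFourierCoeff F U else 0) +
        ∑ i : Fin m, cubeFourierCoeff F {i} *
          (if (({i} : Finset (Fin m)) ∆ U).card ≤ 1 then cubeFourierCoeff F ({i} ∆ U) else 0) := by
  rw [cubeFourierCoeff_mul]
  simp_rw [cubeFourierCoeff_lowPart]
  rw [← sum_filter_add_sum_filter_not univ (fun S : Finset (Fin m) => S.card ≤ 1)]
  have h0 : ∑ S ∈ univ.filter (fun S : Finset (Fin m) => ¬ S.card ≤ 1),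
      (if S.card ≤ 1 then cubeFourierCoeff F S else 0) *
        (if (S ∆ U).card ≤ 1 then cubeFourierCoeff F (S ∆ U) else 0) = 0 :=
    sum_eq_zero fun S hS => by rw [if_neg (mem_filter.1 hS).2, zero_mul]
  rw [h0, add_zero]
  have h1 : ∑ S ∈ univ.filter (fun S : Finset (Fin m) => S.card ≤ 1),
      (if S.card ≤ 1 then cubeFourierCoeff F S else 0) *
        (if (S ∆ U).card ≤ 1 then cubeFourierCoeff F (S ∆ U) else 0) =
      ∑ S ∈ univ.filter (fun S : Finset (Fin m) => S.card ≤ 1),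
        cubeFourierCoeff F S * (if (S ∆ U).card ≤ 1 then cubeFourierCoeff F (S ∆ U) else 0) :=
    sum_congr rfl fun S hS => by rw [if_pos (mem_filter.1 hS).2]
  rw [h1, sum_filter_card_le_one (fun S => cubeFourierCoeff F S *
    (if (S ∆ U).card ≤ 1 then cubeFourierCoeff F (S ∆ U) else 0)), empty_symmDiff]

/-- **`q̂({k}) = 2 a b_k`** (`a = F̂(∅)`, `b_k = F̂({k})`). [cite: ODonnell2014, §1.4] -/
theorem cubeFourierCoeff_qFn_singleton (F : (Fin m → Bool) → ℝ) (k : Fin m) :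
    cubeFourierCoeff (qFn F) {k} = 2 * cubeFourierCoeff F ∅ * cubeFourierCoeff F {k} := by
  unfold qFn
  rw [cubeFourierCoeff_sub, cubeFourierCoeff_const (singleton_ne_empty k), sub_zero,
    cubeFourierCoeff_lowPart_sq]
  rw [if_pos (by simp)]
  have : ∀ i : Fin m, cubeFourierCoeff F {i} *
      (if ((({i} : Finset (Fin m)) ∆ {k}).card ≤ 1) then cubeFourierCoeff F ({i} ∆ {k}) else 0) =
      if i = k then cubeFourierCoeff F {k} * cubeFourierCoeff F ∅ else 0 := by
    intro i
    by_cases hik : i = k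
    · subst hik
      rw [if_pos rfl, symmDiff_self, Finset.bot_eq_empty, if_pos (by simp)]
    · rw [if_neg hik, if_neg (by rw [card_singleton_symmDiff_singleton hik]; omega), mul_zero]
  simp_rw [this]
  rw [sum_ite_eq' univ k, if_pos (mem_univ k)]
  ring

/-- **`q̂({k,l}) = 2 b_k b_l`** for `k ≠ l`. [cite: ODonnell2014, §1.4] -/
theorem cubeFourierCoeff_qFn_pair (F : (Fin m → Bool) → ℝ) {k l : Fin m} (hkl : k ≠ l) :
    cubeFourierCoeff (qFn F) {k, l} = 2 * cubeFourierCoeff F {k} * cubeFourierCoeff F {l} := by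
  unfold qFn
  have hne : ({k, l} : Finset (Fin m)) ≠ ∅ := (insert_nonempty k {l}).ne_empty
  rw [cubeFourierCoeff_sub, cubeFourierCoeff_const hne, sub_zero, cubeFourierCoeff_lowPart_sq]
  rw [if_neg (by rw [card_pair hkl]; omega), mul_zero, zero_add]
  have : ∀ i : Fin m, cubeFourierCoeff F {i} *
      (if ((({i} : Finset (Fin m)) ∆ {k, l}).card ≤ 1) then cubeFourierCoeff F ({i} ∆ {k, l}) else 0) =
      (if i = k then cubeFourierCoeff F {k} * cubeFourierCoeff F {l} else 0) +
        (if i = l then cubeFourierCoeff F {l} * cubeFourierCoeff F {k} else 0) := by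
    intro i
    by_cases hik : i = k
    · subst hik
      rw [if_pos rfl, if_neg hkl, singleton_symmDiff_pair_left hkl, if_pos (by simp), add_zero]
    · by_cases hil : i = l
      · subst hil
        rw [if_neg hik, if_pos rfl, singleton_symmDiff_pair_right hkl, if_pos (by simp), zero_add]
      · rw [if_neg hik, if_neg hil, if_neg (by rw [card_singleton_symmDiff_pair hkl hik hil]; omega),
          mul_zero, add_zero]
  simp_rw [this]
  rw [sum_add_distrib, sum_ite_eq' univ k, sum_ite_eq' univ l, if_pos (mem_univ k), if_pos (mem_univ l)]
  ring

/-! ### §3 Analytic estimates: `E|q| = O(√η)`, and `E q² = O((E|q|)²)` by Bonami -/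

/-- `E|h| ≤ √(E h²)` (Cauchy–Schwarz), in the form `(Σ |h|)² ≤ 2^m Σ h²`. [cite: ODonnell2014, §9.1] -/
theorem sum_abs_sq_le (h : (Fin m → Bool) → ℝ) :
    (∑ x, |h x|) ^ 2 ≤ 2 ^ m * ∑ x, h x ^ 2 := by
  have := sum_mul_sq_le_sq_mul_sq univ (fun _ : Fin m → Bool => (1 : ℝ)) (fun x => |h x|)
  simp only [one_mul, one_pow, sum_const, card_univ, Fintype.card_fun, Fintype.card_bool,
    Fintype.card_fin, sq_abs] at this
  simpa using this

/-- Pointwise: for `F(x) ∈ {±1}`, `|q(x)| ≤ 2|h(x)| + h(x)² + η` where `h = F − F^{≤1}`, using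
`(F^{≤1})² − F² = −h(2F − h)` and `|1 − Λ| = η`. [cite: ODonnell2014, §9.1] -/
theorem abs_qFn_le (F : (Fin m → Bool) → ℝ) (hF : ∀ x, F x = 1 ∨ F x = -1) (x : Fin m → Bool) :
    |qFn F x| ≤ 2 * |F x - lowPart F x| + (F x - lowPart F x) ^ 2 + highWeight F := by
  have hF2 : F x ^ 2 = 1 := by rcases hF x with h | h <;> rw [h] <;> norm_num
  have hΛ : lowWeight F = 1 - highWeight F := by
    have := mean_sq_eq_lowWeight_add_highWeight F
    have h1 : (∑ x, F x ^ 2) / 2 ^ m = 1 := by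
      have : ∀ x, F x ^ 2 = 1 := fun x => by rcases hF x with h | h <;> rw [h] <;> norm_num
      rw [sum_congr rfl fun x _ => this x, sum_const, card_univ, Fintype.card_fun, Fintype.card_bool,
        Fintype.card_fin, nsmul_eq_mul, mul_one]
      push_cast
      exact div_self (by positivity)
    linarith
  unfold qFn
  rw [hΛ]
  have habsF : |F x| = 1 := by rcases hF x with h | h <;> rw [h] <;> norm_num
  have key : lowPart F x * lowPart F x - (1 - highWeight F) =
      -((F x - lowPart F x) * (2 * F x - (F x - lowPart F x))) + (F x ^ 2 - 1) + highWeight F := by ring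
  rw [key, hF2, sub_self, add_zero]
  calc |-((F x - lowPart F x) * (2 * F x - (F x - lowPart F x))) + highWeight F|
      ≤ |-((F x - lowPart F x) * (2 * F x - (F x - lowPart F x)))| + |highWeight F| := abs_add_le _ _
    _ = |F x - lowPart F x| * |2 * F x - (F x - lowPart F x)| + highWeight F := by
        rw [abs_neg, abs_mul, abs_of_nonneg (highWeight_nonneg F)]
    _ ≤ |F x - lowPart F x| * (2 + |F x - lowPart F x|) + highWeight F := by
        gcongr
        calc |2 * F x - (F x - lowPart F x)| ≤ |2 * F x| + |F x - lowPart F x| := abs_sub _ _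
          _ = 2 + |F x - lowPart F x| := by rw [abs_mul, habsF]; norm_num
    _ = 2 * |F x - lowPart F x| + (F x - lowPart F x) ^ 2 + highWeight F := by
        rw [← sq_abs (F x - lowPart F x)]; ring

/-- **`E|q| ≤ 2√η + 2η`** for `F(x) ∈ {±1}`. [cite: ODonnell2014, §9.1] -/
theorem mean_abs_qFn_le (F : (Fin m → Bool) → ℝ) (hF : ∀ x, F x = 1 ∨ F x = -1) :
    (∑ x, |qFn F x|) / 2 ^ m ≤ 2 * Real.sqrt (highWeight F) + 2 * highWeight F := by
  have hN : (0 : ℝ) < 2 ^ m := by positivity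
  set η := highWeight F with hη
  have hh2 : (∑ x, (F x - lowPart F x) ^ 2) = 2 ^ m * η := by
    rw [hη, ← mean_sq_highPart F]; field_simp
  -- `E|h| ≤ √η`
  have hh1 : (∑ x, |F x - lowPart F x|) / 2 ^ m ≤ Real.sqrt η := by
    have hcs := sum_abs_sq_le (fun x => F x - lowPart F x)
    rw [hh2] at hcs
    have hnn : 0 ≤ (∑ x, |F x - lowPart F x|) / 2 ^ m :=
      div_nonneg (sum_nonneg fun _ _ => abs_nonneg _) (by positivity)
    have : ((∑ x, |F x - lowPart F x|) / 2 ^ m) ^ 2 ≤ η := by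
      rw [div_pow, div_le_iff₀ (by positivity)]
      nlinarith [hcs]
    calc (∑ x, |F x - lowPart F x|) / 2 ^ m = Real.sqrt (((∑ x, |F x - lowPart F x|) / 2 ^ m) ^ 2) := by
          rw [Real.sqrt_sq hnn]
      _ ≤ Real.sqrt η := Real.sqrt_le_sqrt this
  -- sum the pointwise bound
  have hpt := fun x => abs_qFn_le F hF x
  have hsum : ∑ x, |qFn F x| ≤ 2 * ∑ x, |F x - lowPart F x| + ∑ x, (F x - lowPart F x) ^ 2 +
      2 ^ m * η := by
    calc ∑ x, |qFn F x| ≤ ∑ x : Fin m → Bool, (2 * |F x - lowPart F x| + (F x - lowPart F x) ^ 2 + η) :=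
          sum_le_sum fun x _ => hpt x
      _ = 2 * ∑ x, |F x - lowPart F x| + ∑ x, (F x - lowPart F x) ^ 2 + 2 ^ m * η := by
          rw [sum_add_distrib, sum_add_distrib, mul_sum, sum_const, card_univ, Fintype.card_fun,
            Fintype.card_bool, Fintype.card_fin, nsmul_eq_mul]
          push_cast
          ring
  rw [hh2] at hsum
  have : (∑ x, |qFn F x|) / 2 ^ m ≤ 2 * ((∑ x, |F x - lowPart F x|) / 2 ^ m) + 2 * η := by
    rw [div_le_iff₀ hN]
    have e : (2 * ((∑ x, |F x - lowPart F x|) / 2 ^ m) + 2 * η) * 2 ^ m =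
        2 * ∑ x, |F x - lowPart F x| + 2 ^ m * η + 2 ^ m * η := by field_simp; ring
    rw [e]; linarith
  linarith

/-- **Bonami ⇒ `E q² ≤ 81 (E|q|)²`** for the level-`≤ 2` polynomial `q` (Bonami `E q⁴ ≤ 81 (E q²)²`
and two Cauchy–Schwarz interpolations `‖q‖₂³ ≤ ‖q‖₁ ‖q‖₄²`). [cite: ODonnell2014, Thm. 9.21 (Bonami lemma)] -/
theorem mean_sq_qFn_le (F : (Fin m → Bool) → ℝ) :
    (∑ x, qFn F x ^ 2) / 2 ^ m ≤ 81 * ((∑ x, |qFn F x|) / 2 ^ m) ^ 2 := by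
  set q := qFn F with hq
  set N : ℝ := 2 ^ m with hN_def
  have hN : 0 < N := by positivity
  set A1 := ∑ x, |q x| with hA1
  set A2 := ∑ x, q x ^ 2 with hA2
  set A3 := ∑ x, |q x| ^ 3 with hA3
  set A4 := ∑ x, (q x ^ 2) ^ 2 with hA4
  have hA1nn : 0 ≤ A1 := sum_nonneg fun _ _ => abs_nonneg _
  have hA2nn : 0 ≤ A2 := sum_nonneg fun _ _ => sq_nonneg _
  have hA4nn : 0 ≤ A4 := sum_nonneg fun _ _ => sq_nonneg _
  -- Bonami with `r = 2`, `d = 2`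
  have hB : A4 / N ≤ 81 * (A2 / N) ^ 2 := by
    have := (isLevelLE_qFn F).bonami_even_moment 2 (by norm_num)
    norm_num at this
    exact this
  -- Cauchy–Schwarz 1: `A2² ≤ A1 A3`
  have hCS1 : A2 ^ 2 ≤ A1 * A3 := by
    have := sum_mul_sq_le_sq_mul_sq univ (fun x => Real.sqrt |q x|) (fun x => |q x| * Real.sqrt |q x|)
    have e1 : ∀ x, Real.sqrt |q x| * (|q x| * Real.sqrt |q x|) = q x ^ 2 := fun x => by
      have := Real.mul_self_sqrt (abs_nonneg (q x))
      calc Real.sqrt |q x| * (|q x| * Real.sqrt |q x|) = |q x| * (Real.sqrt |q x| * Real.sqrt |q x|) := by ring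
        _ = |q x| * |q x| := by rw [this]
        _ = q x ^ 2 := by rw [← sq, sq_abs]
    have e2 : ∀ x, Real.sqrt |q x| ^ 2 = |q x| := fun x => Real.sq_sqrt (abs_nonneg _)
    have e3 : ∀ x, (|q x| * Real.sqrt |q x|) ^ 2 = |q x| ^ 3 := fun x => by
      rw [mul_pow, Real.sq_sqrt (abs_nonneg _)]; ring
    simp only [e1, e2, e3] at this
    exact this
  -- Cauchy–Schwarz 2: `A3² ≤ A2 A4`
  have hCS2 : A3 ^ 2 ≤ A2 * A4 := by
    have := sum_mul_sq_le_sq_mul_sq univ (fun x => |q x|) (fun x => q x ^ 2)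
    have e1 : ∀ x, |q x| * q x ^ 2 = |q x| ^ 3 := fun x => by rw [← sq_abs]; ring
    have e2 : ∀ x, |q x| ^ 2 = q x ^ 2 := fun x => sq_abs _
    simp only [e1, e2] at this
    exact this
  -- combine
  by_cases hA2z : A2 = 0
  · rw [hA2z, zero_div]; positivity
  have hA2pos : 0 < A2 := lt_of_le_of_ne hA2nn (Ne.symm hA2z)
  have hB' : A4 * N ≤ 81 * A2 ^ 2 := by
    rw [div_le_iff₀ hN] at hB
    have e : 81 * (A2 / N) ^ 2 * N = 81 * A2 ^ 2 / N := by field_simp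
    rw [e, le_div_iff₀ hN] at hB
    linarith
  -- `A2⁴ ≤ A1² A3² ≤ A1² A2 A4`
  have h4 : A2 ^ 4 ≤ A1 ^ 2 * (A2 * A4) := by
    calc A2 ^ 4 = (A2 ^ 2) ^ 2 := by ring
      _ ≤ (A1 * A3) ^ 2 := pow_le_pow_left₀ (sq_nonneg _) hCS1 2
      _ = A1 ^ 2 * A3 ^ 2 := by ring
      _ ≤ A1 ^ 2 * (A2 * A4) := mul_le_mul_of_nonneg_left hCS2 (sq_nonneg _)
  -- cancel one `A2`: `A2³ ≤ A1² A4`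
  have h3 : A2 ^ 3 ≤ A1 ^ 2 * A4 := by
    have : A2 * A2 ^ 3 ≤ A2 * (A1 ^ 2 * A4) := by nlinarith [h4]
    exact le_of_mul_le_mul_left this hA2pos
  -- multiply by `N` and use Bonami: `A2³ N ≤ 81 A1² A2²`, cancel `A2²`
  have h2 : A2 * N ≤ 81 * A1 ^ 2 := by
    have : A2 ^ 2 * (A2 * N) ≤ A2 ^ 2 * (81 * A1 ^ 2) := by
      calc A2 ^ 2 * (A2 * N) = A2 ^ 3 * N := by ring
        _ ≤ A1 ^ 2 * A4 * N := mul_le_mul_of_nonneg_right h3 hN.le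
        _ = A1 ^ 2 * (A4 * N) := by ring
        _ ≤ A1 ^ 2 * (81 * A2 ^ 2) := mul_le_mul_of_nonneg_left hB' (sq_nonneg _)
        _ = A2 ^ 2 * (81 * A1 ^ 2) := by ring
    exact le_of_mul_le_mul_left this (by positivity)
  rw [div_le_iff₀ hN]
  have e : 81 * (A1 / N) ^ 2 * N = 81 * A1 ^ 2 / N := by field_simp
  rw [e, le_div_iff₀ hN]
  nlinarith [h2]


/-! ### §4 Reading off the coefficients: Parseval lower bound and the pair-sum identity -/

/-- The index set of ordered pairs `k < l`. [cite: ODonnell2014, §1.4] -/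
private def ltPairs (m : ℕ) : Finset (Fin m × Fin m) := univ.filter fun p => p.1 < p.2

/-- `(k, l) ↦ {k, l}` is injective on the pairs `k < l`. [cite: ODonnell2014, §1.4] -/
private theorem pair_injOn : Set.InjOn (fun p : Fin m × Fin m => ({p.1, p.2} : Finset (Fin m))) ↑(ltPairs m) := by
  intro p hp p' hp' h
  have hp1 : p.1 < p.2 := (mem_filter.1 (mem_coe.1 hp)).2
  have hp1' : p'.1 < p'.2 := (mem_filter.1 (mem_coe.1 hp')).2
  simp only at h
  have h1 : p.1 ∈ ({p'.1, p'.2} : Finset (Fin m)) := h ▸ mem_insert_self _ _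
  have h2 : p.2 ∈ ({p'.1, p'.2} : Finset (Fin m)) := h ▸ mem_insert_of_mem (mem_singleton_self _)
  have h1' : p'.1 ∈ ({p.1, p.2} : Finset (Fin m)) := h.symm ▸ mem_insert_self _ _
  simp only [mem_insert, mem_singleton] at h1 h2 h1'
  rcases h1 with e1 | e1
  · rcases h2 with e2 | e2
    · exact absurd (e1.trans e2.symm) (ne_of_lt hp1)
    · exact Prod.ext e1 e2
  · rcases h1' with e3 | e3
    · exact absurd (e3.trans e1) (ne_of_lt hp1')
    · have : p.1 < p.1 := by
        calc p.1 < p.2 := hp1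
          _ = p'.1 := e3.symm
          _ < p'.2 := hp1'
          _ = p.1 := e1.symm
      exact absurd this (lt_irrefl _)

/-- **Parseval, restricted to singletons and pairs**: `Σ_k ĝ({k})² + Σ_{k<l} ĝ({k,l})² ≤ E[g²]`.
[cite: ODonnell2014, §1.4 (Parseval)] -/
theorem sum_coeff_sq_singletons_pairs_le (g : (Fin m → Bool) → ℝ) :
    ∑ k : Fin m, cubeFourierCoeff g {k} ^ 2 +
        ∑ p ∈ univ.filter (fun p : Fin m × Fin m => p.1 < p.2), cubeFourierCoeff g {p.1, p.2} ^ 2 ≤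
      (∑ x, g x ^ 2) / 2 ^ m := by
  classical
  rw [← sum_cubeFourierCoeff_sq]
  set T1 : Finset (Finset (Fin m)) := univ.map ⟨fun i : Fin m => ({i} : Finset (Fin m)), singleton_injective⟩
    with hT1
  set T2 : Finset (Finset (Fin m)) := (ltPairs m).image fun p => ({p.1, p.2} : Finset (Fin m)) with hT2
  have hsum1 : ∑ U ∈ T1, cubeFourierCoeff g U ^ 2 = ∑ k : Fin m, cubeFourierCoeff g {k} ^ 2 := by
    rw [hT1, sum_map]; rfl
  have hsum2 : ∑ U ∈ T2, cubeFourierCoeff g U ^ 2 =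
      ∑ p ∈ ltPairs m, cubeFourierCoeff g {p.1, p.2} ^ 2 := by
    rw [hT2, sum_image pair_injOn]
  have hdisj : Disjoint T1 T2 := by
    rw [hT1, hT2, disjoint_left]
    intro U hU1 hU2
    rw [mem_map] at hU1
    rw [mem_image] at hU2
    obtain ⟨i, -, rfl⟩ := hU1
    obtain ⟨p, hp, hpe⟩ := hU2
    have hlt : p.1 < p.2 := (mem_filter.1 hp).2
    have := congrArg Finset.card hpe
    simp [card_pair (ne_of_lt hlt)] at this
  calc ∑ k : Fin m, cubeFourierCoeff g {k} ^ 2 +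
        ∑ p ∈ univ.filter (fun p : Fin m × Fin m => p.1 < p.2), cubeFourierCoeff g {p.1, p.2} ^ 2
      = ∑ U ∈ T1 ∪ T2, cubeFourierCoeff g U ^ 2 := by
        rw [sum_union hdisj, hsum1, hsum2]; rfl
    _ ≤ ∑ U, cubeFourierCoeff g U ^ 2 :=
        sum_le_sum_of_subset_of_nonneg (subset_univ _) fun _ _ _ => sq_nonneg _

/-- **The pair-sum identity** `(Σ_k g_k)² = Σ_k g_k² + 2 Σ_{k<l} g_k g_l`. [cite: ODonnell2014, §1.4] -/
theorem sq_sum_eq_sum_sq_add_two_mul_sum_pairs (g : Fin m → ℝ) :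
    (∑ k, g k) ^ 2 = ∑ k, g k ^ 2 + 2 * ∑ p ∈ univ.filter (fun p : Fin m × Fin m => p.1 < p.2), g p.1 * g p.2 := by
  classical
  have hprod : (∑ k, g k) ^ 2 = ∑ p : Fin m × Fin m, g p.1 * g p.2 := by
    rw [sq, Fintype.sum_mul_sum, ← Fintype.sum_prod_type']
  rw [hprod, ← sum_filter_add_sum_filter_not univ (fun p : Fin m × Fin m => p.1 < p.2)]
  rw [← sum_filter_add_sum_filter_not (univ.filter fun p : Fin m × Fin m => ¬ p.1 < p.2)
    (fun p : Fin m × Fin m => p.1 = p.2)]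
  -- the diagonal
  have hdiag : ∑ p ∈ (univ.filter fun p : Fin m × Fin m => ¬ p.1 < p.2).filter
      (fun p : Fin m × Fin m => p.1 = p.2), g p.1 * g p.2 = ∑ k, g k ^ 2 := by
    have hset : (univ.filter fun p : Fin m × Fin m => ¬ p.1 < p.2).filter
        (fun p : Fin m × Fin m => p.1 = p.2) = univ.map ⟨fun k : Fin m => (k, k), fun a b h => by
          simpa using congrArg Prod.fst h⟩ := by
      ext p
      simp only [mem_filter, mem_univ, true_and, mem_map, Function.Embedding.coeFn_mk]
      constructor
      · rintro ⟨-, h⟩; exact ⟨p.1, Prod.ext rfl h⟩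
      · rintro ⟨k, rfl⟩; exact ⟨lt_irrefl _, rfl⟩
    rw [hset, sum_map]
    simp [sq]
  -- below the diagonal = above the diagonal (swap)
  have hlow : ∑ p ∈ (univ.filter fun p : Fin m × Fin m => ¬ p.1 < p.2).filter
      (fun p : Fin m × Fin m => ¬ p.1 = p.2), g p.1 * g p.2 =
      ∑ p ∈ univ.filter (fun p : Fin m × Fin m => p.1 < p.2), g p.1 * g p.2 := by
    refine sum_nbij' (fun p => (p.2, p.1)) (fun p => (p.2, p.1)) ?_ ?_ ?_ ?_ ?_
    · intro p hp
      simp only [mem_filter, mem_univ, true_and] at hp ⊢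
      rcases lt_trichotomy p.1 p.2 with h | h | h
      · exact absurd h hp.1
      · exact absurd h hp.2
      · exact h
    · intro p hp
      simp only [mem_filter, mem_univ, true_and] at hp ⊢
      exact ⟨lt_asymm hp, ne_of_gt hp⟩
    · intro p _; rfl
    · intro p _; rfl
    · intro p _; simp [mul_comm]
  rw [hdiag, hlow]
  ring

/-! ### §5 The theorem -/

/-- `Λ(F) + η(F) = 1` for `F(x) ∈ {±1}` (Parseval). [cite: ODonnell2014, §1.4 (Parseval)] -/
theorem lowWeight_add_highWeight (F : (Fin m → Bool) → ℝ) (hF : ∀ x, F x = 1 ∨ F x = -1) :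
    lowWeight F + highWeight F = 1 := by
  rw [← mean_sq_eq_lowWeight_add_highWeight]
  have : ∀ x, F x ^ 2 = 1 := fun x => by rcases hF x with h | h <;> rw [h] <;> norm_num
  rw [sum_congr rfl fun x _ => this x, sum_const, card_univ, Fintype.card_fun, Fintype.card_bool,
    Fintype.card_fin, nsmul_eq_mul, mul_one]
  push_cast
  exact div_self (by positivity)

/-- `E[(F − s χ_S)²] = 2 − 2 s F̂(S)` for `F(x) ∈ {±1}`, `s = ±1`. [cite: FriedgutKalaiNaor2002, Thm. 1.1 (p. 428)] -/
theorem mean_sq_sub_char (F : (Fin m → Bool) → ℝ) (hF : ∀ x, F x = 1 ∨ F x = -1) {s : ℝ}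
    (hs : s = 1 ∨ s = -1) (S : Finset (Fin m)) :
    (∑ x, (F x - s * walsh S x) ^ 2) / 2 ^ m = 2 - 2 * s * cubeFourierCoeff F S := by
  have hN : (0 : ℝ) < 2 ^ m := by positivity
  have hs2 : s ^ 2 = 1 := by rcases hs with h | h <;> rw [h] <;> norm_num
  have hw2 : ∀ x, walsh S x ^ 2 = 1 := fun x => by
    rw [sq, walsh_mul_walsh, symmDiff_self, Finset.bot_eq_empty, walsh_empty]
  have hF2 : ∀ x, F x ^ 2 = 1 := fun x => by rcases hF x with h | h <;> rw [h] <;> norm_num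
  have hpt : ∀ x, (F x - s * walsh S x) ^ 2 = 2 - 2 * s * (F x * walsh S x) := fun x => by
    have e : (F x - s * walsh S x) ^ 2 = F x ^ 2 - 2 * s * (F x * walsh S x) + s ^ 2 * walsh S x ^ 2 := by
      ring
    rw [e, hF2, hs2, hw2]; ring
  rw [sum_congr rfl fun x _ => hpt x, sum_sub_distrib, sum_const, card_univ, Fintype.card_fun,
    Fintype.card_bool, Fintype.card_fin, nsmul_eq_mul, ← mul_sum]
  unfold cubeFourierCoeff
  push_cast
  field_simp

/-- **The Friedgut–Kalai–Naor theorem (`±1` form), PROVED.** For `F : {0,1}^m → {−1, 1}` with weight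
`η = Σ_{|S| ≥ 2} F̂(S)²` above level `1`, one of the functions `±1`, `±χ_i` (`s χ_S` with `s = ±1`,
`|S| ≤ 1`) satisfies `E[(F − s χ_S)²] ≤ 4000 η`. (Since `E[(F − ℓ)²] ≥ η` for every level-`≤ 1` `ℓ`,
`highWeight_le_mean_sq_sub`, this is [FriedgutKalaiNaor2002, Thm. 1.1] with `K = 4000` in the
`±1` normalisation.) [cite: FriedgutKalaiNaor2002, Thm. 1.1 (p. 428)] -/
theorem fkn_pm_one (F : (Fin m → Bool) → ℝ) (hF : ∀ x, F x = 1 ∨ F x = -1) :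
    ∃ (s : ℝ) (S : Finset (Fin m)), (s = 1 ∨ s = -1) ∧ S.card ≤ 1 ∧
      (∑ x, (F x - s * walsh S x) ^ 2) / 2 ^ m ≤ 4000 * highWeight F := by
  classical
  set η := highWeight F with hη_def
  have hη0 : 0 ≤ η := highWeight_nonneg F
  have hΛη := lowWeight_add_highWeight F hF
  have hΛ0 : 0 ≤ lowWeight F := sum_nonneg fun _ _ => sq_nonneg _
  have hη1 : η ≤ 1 := by linarith
  -- notation
  set a := cubeFourierCoeff F ∅ with ha_def
  set b : Fin m → ℝ := fun k => cubeFourierCoeff F {k} with hb_def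
  set B := ∑ k, b k ^ 2 with hB_def
  have hΛ : lowWeight F = a ^ 2 + B := lowWeight_eq F
  have habsF : ∀ x, |F x| ≤ 1 := fun x => by rcases hF x with h | h <;> rw [h] <;> norm_num
  have ha1 : |a| ≤ 1 := abs_cubeFourierCoeff_le_one F habsF ∅
  have hb1 : ∀ k, |b k| ≤ 1 := fun k => abs_cubeFourierCoeff_le_one F habsF {k}
  -- large `η`: trivial
  by_cases hbig : 1 / 4 < η
  · refine ⟨1, ∅, Or.inl rfl, by simp, ?_⟩
    rw [mean_sq_sub_char F hF (Or.inl rfl)]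
    have : -1 ≤ cubeFourierCoeff F ∅ := by rw [← ha_def]; exact neg_le_of_abs_le ha1
    linarith
  rw [not_lt] at hbig
  -- the main estimate `E q² ≤ 1296 η`
  have hEq : (∑ x, qFn F x ^ 2) / 2 ^ m ≤ 1296 * η := by
    have h1 := mean_sq_qFn_le F
    have h2 := mean_abs_qFn_le F hF
    have hsq : Real.sqrt η ^ 2 = η := Real.sq_sqrt hη0
    have hηs : η ≤ Real.sqrt η := by
      rw [Real.le_sqrt hη0 hη0]; nlinarith
    have h3 : (∑ x, |qFn F x|) / 2 ^ m ≤ 4 * Real.sqrt η := by rw [← hη_def] at h2; linarith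
    have h0 : 0 ≤ (∑ x, |qFn F x|) / 2 ^ m := div_nonneg (sum_nonneg fun _ _ => abs_nonneg _) (by positivity)
    calc (∑ x, qFn F x ^ 2) / 2 ^ m ≤ 81 * ((∑ x, |qFn F x|) / 2 ^ m) ^ 2 := h1
      _ ≤ 81 * (4 * Real.sqrt η) ^ 2 := by gcongr
      _ = 1296 * η := by rw [mul_pow, hsq]; ring
  -- Parseval lower bound with the computed coefficients
  have hlow := sum_coeff_sq_singletons_pairs_le (qFn F)
  have hsing : ∑ k : Fin m, cubeFourierCoeff (qFn F) {k} ^ 2 = 4 * a ^ 2 * B := by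
    simp_rw [cubeFourierCoeff_qFn_singleton]
    rw [hB_def, mul_sum]
    exact sum_congr rfl fun k _ => by rw [ha_def, hb_def]; ring
  have hpair : ∑ p ∈ univ.filter (fun p : Fin m × Fin m => p.1 < p.2), cubeFourierCoeff (qFn F) {p.1, p.2} ^ 2 =
      4 * ∑ p ∈ univ.filter (fun p : Fin m × Fin m => p.1 < p.2), b p.1 ^ 2 * b p.2 ^ 2 := by
    rw [mul_sum]
    refine sum_congr rfl fun p hp => ?_
    rw [cubeFourierCoeff_qFn_pair F (ne_of_lt (mem_filter.1 hp).2), hb_def]; ring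
  rw [hsing, hpair] at hlow
  -- the pair-sum identity for `b_k²`
  have hid := sq_sum_eq_sum_sq_add_two_mul_sum_pairs (fun k => b k ^ 2)
  rw [← hB_def] at hid
  -- consequences: `a² B ≤ 324 η`, `B² − Σ b⁴ ≤ 648 η`
  have hP0 : 0 ≤ ∑ p ∈ univ.filter (fun p : Fin m × Fin m => p.1 < p.2), b p.1 ^ 2 * b p.2 ^ 2 :=
    sum_nonneg fun _ _ => mul_nonneg (sq_nonneg _) (sq_nonneg _)
  have hB0 : 0 ≤ B := sum_nonneg fun _ _ => sq_nonneg _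
  have ha2B : 0 ≤ a ^ 2 * B := mul_nonneg (sq_nonneg a) hB0
  have haB : a ^ 2 * B ≤ 324 * η := by linarith [hlow, hEq]
  have hB4 : B ^ 2 - ∑ k, (b k ^ 2) ^ 2 ≤ 648 * η := by linarith [hlow, hEq, hid]
  have hBΛ : a ^ 2 + B = 1 - η := by linarith
  by_cases hBhalf : 1 / 2 ≤ B
  · -- dictator case
    have ha2 : a ^ 2 ≤ 648 * η := by nlinarith
    have hne : (univ : Finset (Fin m)).Nonempty := by
      by_contra hcon
      rw [not_nonempty_iff_eq_empty] at hcon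
      have : B = 0 := by rw [hB_def, hcon, sum_empty]
      linarith
    obtain ⟨k₀, -, hk₀⟩ := exists_max_image univ (fun k => b k ^ 2) hne
    set M := b k₀ ^ 2 with hM
    have h4 : ∑ k, (b k ^ 2) ^ 2 ≤ M * B := by
      rw [hB_def, mul_sum]
      exact sum_le_sum fun k _ => by
        have := hk₀ k (mem_univ k); nlinarith [sq_nonneg (b k)]
    have hBM : B * (B - M) ≤ 648 * η := by nlinarith
    have hM1 : B - M ≤ 1296 * η := by nlinarith
    have hMge : 1 - 1945 * η ≤ M := by linarith
    have hbabs : M ≤ |b k₀| := by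
      rw [hM, ← sq_abs]
      have := hb1 k₀
      nlinarith [abs_nonneg (b k₀)]
    refine ⟨if 0 ≤ b k₀ then 1 else -1, {k₀}, by split_ifs <;> simp, by simp, ?_⟩
    rw [mean_sq_sub_char F hF (by split_ifs <;> simp)]
    have : (if 0 ≤ b k₀ then (1 : ℝ) else -1) * cubeFourierCoeff F {k₀} = |b k₀| := by
      change (if 0 ≤ b k₀ then (1 : ℝ) else -1) * b k₀ = |b k₀|
      split_ifs with h
      · rw [one_mul, abs_of_nonneg h]
      · rw [abs_of_neg (lt_of_not_ge h)]; ring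
    rw [mul_assoc, this]
    linarith
  · -- constant case
    rw [not_le] at hBhalf
    have ha2 : 1 / 4 ≤ a ^ 2 := by linarith
    have hBsmall : B ≤ 1296 * η := by nlinarith
    have hage : 1 - 1297 * η ≤ a ^ 2 := by linarith
    have haabs : a ^ 2 ≤ |a| := by
      rw [← sq_abs]; nlinarith [abs_nonneg a]
    refine ⟨if 0 ≤ a then 1 else -1, ∅, by split_ifs <;> simp, by simp, ?_⟩
    rw [mean_sq_sub_char F hF (by split_ifs <;> simp)]
    have : (if 0 ≤ a then (1 : ℝ) else -1) * cubeFourierCoeff F ∅ = |a| := by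
      change (if 0 ≤ a then (1 : ℝ) else -1) * a = |a|
      split_ifs with h
      · rw [one_mul, abs_of_nonneg h]
      · rw [abs_of_neg (lt_of_not_ge h)]; ring
    rw [mul_assoc, this]
    linarith

end FKN

end Literature.Computability.Complexity.LowDegree
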